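import Summits.CriticalPhenomena.Ising3DConformalLimit.Theorems.EnergyNotSigmaSquaredMoebiusLimitExistsDefs
import Mathlib.Topology.MetricSpace.Thickening
import Mathlib.Analysis.InnerProductSpace.PiL2
import HarnessLib

/-!
# Telescoping: single-variable ⇒ joint asymptotic equicontinuity
(line `only-interaction-breaks-moebius` of the crux `MoebiusLimitExists`, item stmt-CriticalPhenomena-1344,
route `EnergyNotSigmaSquared`; registered toolkit stub `telescoping_equicontinuity`)

A purely topological reduction used by the asymptotic-equicontinuity step of the line. For a sequence of
functions `F k` on the configuration space `(ℝ³)ᴺ = Fin N → EuclideanSpace ℝ (Fin 3)` (sup metric) and an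
open set `s`: if on every compact `K' ⊆ s` and for every index `i` the family is asymptotically
equicontinuous under moves of the `i`-th point ALONE, then it is asymptotically equicontinuous (jointly,
all points moving) on every compact `K ⊆ s`.

Proof. `N = 0`: the configuration space is one point. `N ≥ 1`: choose `r > 0` with the closed
`r`-thickening `K'` of `K` inside `s` (`IsCompact.exists_cthickening_subset_open`); `K'` is compact
because `(ℝ³)ᴺ` is proper (`IsCompact.cthickening`). Apply the hypothesis on `K'` for each of the `N`
indices with `ε/N`, take `η = min r (min_i η_i)` and intersect the `N` eventualities
(`Filter.eventually_all`). For `x, y ∈ K` with `dist x y < η` the HYBRID configurations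
`z_l = (y₀,…,y_{l−1}, x_l,…,x_{N−1})` satisfy `dist z_l x ≤ dist y x < r` in the sup metric, so
`z_l ∈ K'`; consecutive hybrids differ in the single coordinate `l` and are `≤ dist x y < η_l` apart, so
each increment `|F k z_l − F k z_{l+1}|` is `< ε/N`, and `F k x − F k y = ∑_{l<N} (F k z_l − F k z_{l+1})`
telescopes (`Finset.sum_range_sub'`).

References: folklore real analysis (Mathlib: `Metric.cthickening`, `dist_pi_le_iff`,
`dist_le_pi_dist`, `Finset.abs_sum_le_sum_abs`). No definitions are introduced.
-/

noncomputable section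

open Filter Topology Set Function

namespace Summit.CriticalPhenomena.Ising3DConformalLimit.MoebiusLimitExistsOnlyInteraction

/-- **TELESCOPING: single-variable ⇒ joint asymptotic equicontinuity (toolkit, pure topology).**
For functions `F k` on `(ℝ³)ᴺ` and an open set `s`: if on every compact `K' ⊆ s` and for every index
`i` the family is asymptotically equicontinuous under moves of the `i`-th point alone, then it is
asymptotically equicontinuous on every compact `K ⊆ s`. Proof: hybrid configurations inside a compact
closed thickening of `K` in `s`, `N` increments each eventually `< ε/N`, telescoping sum; `N = 0` is
trivial. [folklore] -/
theorem telescoping_equicontinuity :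
    ∀ (N : ℕ) (F : ℕ → (Fin N → EuclideanSpace ℝ (Fin 3)) → ℝ)
      (s : Set (Fin N → EuclideanSpace ℝ (Fin 3))), IsOpen s →
      (∀ K' : Set (Fin N → EuclideanSpace ℝ (Fin 3)), IsCompact K' → K' ⊆ s →
        ∀ i : Fin N, ∀ ε > 0, ∃ η > 0, ∀ᶠ k in atTop, ∀ x ∈ K', ∀ x' ∈ K',
          (∀ j, j ≠ i → x' j = x j) → dist x x' < η → |F k x - F k x'| < ε) →
      ∀ K : Set (Fin N → EuclideanSpace ℝ (Fin 3)), IsCompact K → K ⊆ s →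
        ∀ ε > 0, ∃ η > 0, ∀ᶠ k in atTop, ∀ x ∈ K, ∀ y ∈ K, dist x y < η → |F k x - F k y| < ε := by
  intro N F s hs hF K hK hKs ε hε
  rcases Nat.eq_zero_or_pos N with hN | hN
  · -- `N = 0`: the configuration space is a single point.
    subst hN
    refine ⟨1, one_pos, Filter.Eventually.of_forall fun k x _ y _ _ => ?_⟩
    have hxy : x = y := funext fun j => Fin.elim0 j
    rw [hxy, sub_self, abs_zero]
    exact hε
  -- `N ≥ 1`: a compact closed thickening `K'` of `K` inside `s`.
  obtain ⟨r, hr, hrs⟩ := hK.exists_cthickening_subset_open hs hKs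
  have hK' : IsCompact (Metric.cthickening r K) := hK.cthickening
  have hNpos : (0 : ℝ) < N := by exact_mod_cast hN
  have hεN : 0 < ε / N := div_pos hε hNpos
  choose η hη hev using fun i : Fin N => hF (Metric.cthickening r K) hK' hrs i (ε / N) hεN
  have hne : (Finset.univ : Finset (Fin N)).Nonempty := ⟨⟨0, hN⟩, Finset.mem_univ _⟩
  obtain ⟨η₀, hη₀, hη₀le⟩ : ∃ η₀ : ℝ, 0 < η₀ ∧ ∀ i, η₀ ≤ η i :=
    ⟨Finset.univ.inf' hne η, (Finset.lt_inf'_iff hne).mpr fun i _ => hη i,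
      fun i => Finset.inf'_le η (Finset.mem_univ i)⟩
  refine ⟨min r η₀, lt_min hr hη₀, ?_⟩
  have hall : ∀ᶠ k in atTop, ∀ i : Fin N, ∀ x ∈ Metric.cthickening r K,
      ∀ x' ∈ Metric.cthickening r K, (∀ j, j ≠ i → x' j = x j) → dist x x' < η i →
        |F k x - F k x'| < ε / N :=
    Filter.eventually_all.mpr hev
  filter_upwards [hall] with k hk
  intro x hx y hy hxy
  have hxyr : dist x y < r := lt_of_lt_of_le hxy (min_le_left _ _)
  have hxyη : dist x y < η₀ := lt_of_lt_of_le hxy (min_le_right _ _)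
  -- The hybrid configurations `z l = (y₀, …, y_{l-1}, x_l, …, x_{N-1})`.
  set z : ℕ → (Fin N → EuclideanSpace ℝ (Fin 3)) := fun l j => if (j : ℕ) < l then y j else x j
    with hz
  have hz0 : z 0 = x := by
    funext j
    simp [hz]
  have hzN : z N = y := by
    funext j
    simp [hz, j.isLt]
  have hzK' : ∀ l, z l ∈ Metric.cthickening r K := by
    intro l
    refine Metric.mem_cthickening_of_dist_le (z l) x r K hx ?_
    refine (dist_pi_le_iff hr.le).mpr fun j => ?_
    by_cases h : (j : ℕ) < l
    · simp only [hz, h, if_true]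
      exact (dist_le_pi_dist y x j).trans (by rw [dist_comm]; exact hxyr.le)
    · simp only [hz, h, if_false, dist_self]
      exact hr.le
  have hzdist : ∀ l, dist (z l) (z (l + 1)) ≤ dist x y := by
    intro l
    refine (dist_pi_le_iff dist_nonneg).mpr fun j => ?_
    by_cases h : (j : ℕ) < l
    · have h' : (j : ℕ) < l + 1 := Nat.lt_succ_of_lt h
      simp only [hz, h, h', if_true, dist_self]
      exact dist_nonneg
    · by_cases h' : (j : ℕ) < l + 1
      · simp only [hz, h, h', if_true, if_false]
        exact dist_le_pi_dist x y j
      · simp only [hz, h, h', if_false, dist_self]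
        exact dist_nonneg
  have hzdiff : ∀ (l : ℕ) (hl : l < N), ∀ j : Fin N, j ≠ ⟨l, hl⟩ → z (l + 1) j = z l j := by
    intro l hl j hj
    have hjl : (j : ℕ) ≠ l := fun h => hj (Fin.ext h)
    by_cases h : (j : ℕ) < l
    · have h' : (j : ℕ) < l + 1 := Nat.lt_succ_of_lt h
      simp only [hz, h, h', if_true]
    · have h' : ¬ (j : ℕ) < l + 1 := fun h'' => hjl (by omega)
      simp only [hz, h, h', if_false]
  have hstep : ∀ l ∈ Finset.range N, |F k (z l) - F k (z (l + 1))| < ε / N := by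
    intro l hl
    rw [Finset.mem_range] at hl
    exact hk ⟨l, hl⟩ (z l) (hzK' l) (z (l + 1)) (hzK' (l + 1)) (hzdiff l hl)
      (lt_of_lt_of_le (lt_of_le_of_lt (hzdist l) hxyη) (hη₀le ⟨l, hl⟩))
  -- Telescoping.
  have htel : F k x - F k y = ∑ l ∈ Finset.range N, (F k (z l) - F k (z (l + 1))) := by
    rw [Finset.sum_range_sub' (fun l => F k (z l)), hz0, hzN]
  calc |F k x - F k y| = |∑ l ∈ Finset.range N, (F k (z l) - F k (z (l + 1)))| := by rw [htel]
    _ ≤ ∑ l ∈ Finset.range N, |F k (z l) - F k (z (l + 1))| := Finset.abs_sum_le_sum_abs _ _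
    _ < ∑ _l ∈ Finset.range N, ε / N :=
        Finset.sum_lt_sum_of_nonempty ⟨0, Finset.mem_range.mpr hN⟩ hstep
    _ = ε := by
        rw [Finset.sum_const, Finset.card_range, nsmul_eq_mul]
        field_simp

end Summit.CriticalPhenomena.Ising3DConformalLimit.MoebiusLimitExistsOnlyInteraction

end
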